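import Summits.Ventures.PercRepro.RankLevelSetFrameQ
import Summits.Ventures.PercRepro.RankLevelSetCrossStep

/-!
# PercRepro — C-025: the wrapper with the cross term folded in — the cross term is positive at every element of the core (night-1, gen 0)

On the rank-`p` core, the cross term of the single-element step at `(p, q+1)` is `D_e = n⁰⁰_{p−1,q+1}(e) − n⁰⁰_{p−1,q}(e)`
(`freeCount_eq_zero_of_eRank` kills the `n⁰⁰_{p,·}` terms), and `n⁰⁰_{p−1,q+1}(e)` counts the partitions `(A, Ā) ∈ U(p, q+1)`
in which `e ∈ A` is a coloop of `M|A` not spanned by `Ā` — «`e` is a FREE COLOOP of the partition». If `D_e ≤ 0` at some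
element the step closes there (`RLS_of_freeCount_le`, from `c025_step_of_delete_contract_cross`); `rls_succ_all_cross`
folds this in: the core may assume `D_e > 0` at EVERY element, i.e. `freeCount M e (p−1) q < freeCount M e (p−1) (q+1)`
for all `e ∈ E` — the hypothesis that is exactly the positivity of the cross term. Axioms: standard.
-/

open scoped Matroid

namespace PercRepro

namespace ThmN

variable {α : Type}

/-- The step closes at a non-loop `e` of a rank-`(p+1)` matroid whenever the cross term is non-positive:
`D_e = n⁰⁰_{p,q+1}(e) − n⁰⁰_{p,q}(e) ≤ 0` (the `n⁰⁰_{p+1,·}` terms vanish in rank `p+1`), in particular when `e` is a free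
coloop of no partition at `(p+1, q+1)` (`freeCount M e p (q+1) = 0`). -/
theorem RLS_of_freeCount_le (M : Matroid α) [M.Finite] {p q : ℕ} {e : α} (he : M.Indep {e})
    (hR : M.eRank = ((p + 1 : ℕ) : ℕ∞)) (h0 : Matroid.freeCount M e p (q + 1) ≤ Matroid.freeCount M e p q)
    (h1 : RLS (M ＼ {e}) (p + 1) (q + 1)) (h2 : RLS (M ／ {e}) p q) : RLS M (p + 1) (q + 1) := by
  rw [RLS_iff] at h1 h2 ⊢
  have heE : e ∈ M.E := he.subset_ground (Set.mem_singleton e)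
  refine Matroid.c025_step_of_delete_contract_cross he p q h1 h2 ?_
  rw [Matroid.freeCount_eq_zero_of_eRank heE hR]
  push_cast
  have hΦ := phiK_succ_succ_le p q
  have hU : (0 : ℚ) ≤ (Matroid.topCount (M ／ {e}) p q : ℚ) := by positivity
  have hF : (0 : ℚ) ≤ (Matroid.freeCount M e (p + 1) (q + 1) : ℚ) := by positivity
  have h0' : (Matroid.freeCount M e p (q + 1) : ℚ) ≤ Matroid.freeCount M e p q := by exact_mod_cast h0
  have hΦ0 : (0 : ℚ) ≤ phiK (p + 1) (q + 1) := by unfold phiK; positivity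
  nlinarith [mul_nonneg hΦ0 hF, mul_nonneg (sub_nonneg.2 hΦ) hU, mul_le_mul_of_nonneg_left h0' hΦ0]

/-- The special case `freeCount M e p (q + 1) = 0`: `e` is a free coloop of no partition at `(p+1, q+1)`. -/
theorem RLS_of_freeCount_eq_zero (M : Matroid α) [M.Finite] {p q : ℕ} {e : α} (he : M.Indep {e})
    (hR : M.eRank = ((p + 1 : ℕ) : ℕ∞)) (h0 : Matroid.freeCount M e p (q + 1) = 0)
    (h1 : RLS (M ＼ {e}) (p + 1) (q + 1)) (h2 : RLS (M ／ {e}) p q) : RLS M (p + 1) (q + 1) :=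
  RLS_of_freeCount_le M he hR (by rw [h0]; exact Nat.zero_le _) h1 h2

/-- **The wrapper at level `q + 1` with the cross term folded in** (the body of `rls_succ_all` with one more case):
the core may assume, besides simplicity, rank `p`, no coloops and an `e`-free partition for every element, that the
cross term is POSITIVE at every element: `freeCount M e (p − 1) q < freeCount M e (p − 1) (q + 1)` (`D_e > 0`) — in
particular every element is a free coloop of some partition of `U(p, q+1)`. -/
theorem rls_succ_all_cross (q : ℕ)
    (hprev : ∀ (M : Matroid α) [M.Finite] (p : ℕ), q + 2 ≤ p → RLS M p q)
    (hcore : ∀ (M : Matroid α) [M.Finite] (p : ℕ), q + 3 ≤ p →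
      (∀ e ∈ M.E, ∀ f ∈ M.E, e ≠ f → M.eRk {e, f} = 2) → M.eRank = (p : ℕ∞) →
      (∀ e, ¬ M.IsColoop e) →
      (∀ e ∈ M.E, ∃ A ⊆ M.E \ {e}, e ∉ M.closure A ∧ e ∉ M.closure ((M.E \ {e}) \ A)) →
      (∀ e ∈ M.E, Matroid.freeCount M e (p - 1) q < Matroid.freeCount M e (p - 1) (q + 1)) → RLS M p (q + 1)) :
    ∀ (M : Matroid α) [M.Finite] (p : ℕ), q + 3 ≤ p → RLS M p (q + 1) := by
  suffices H : ∀ n : ℕ, ∀ (M : Matroid α) [M.Finite], M.E.ncard = n → ∀ p : ℕ, q + 3 ≤ p →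
      RLS M p (q + 1) from fun M _ p hp => H _ M rfl p hp
  intro n
  induction n using Nat.strong_induction_on with
  | _ n ih =>
  intro M _ hn p hp
  classical
  have hdel : ∀ e ∈ M.E, (M ＼ {e}).E.ncard < n := by
    intro e he
    rw [_root_.Matroid.delete_ground, ← hn, ← Set.ncard_sdiff_singleton_add_one he M.ground_finite]
    omega
  -- Case 1: a loop
  by_cases hL : ∃ e ∈ M.E, M.IsLoop e
  · obtain ⟨e, he, hloopE⟩ := hL
    exact RLS_of_loop_q M hloopE p (q + 1) (ih _ (hdel e he) (M ＼ {e}) rfl p hp)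
  push Not at hL
  -- Case 2: a parallel pair
  by_cases hP : ∃ e ∈ M.E, ∃ e' ∈ M.E, e' ≠ e ∧ e ∈ M.closure {e'}
  · obtain ⟨e, he, e', he', hne, hpar⟩ := hP
    have heI : M.Indep {e} := _root_.Matroid.indep_singleton.2 ((_root_.Matroid.not_isLoop_iff he).1 (hL e he))
    obtain ⟨p', rfl⟩ : ∃ p', p = p' + 1 := ⟨p - 1, by omega⟩
    exact RLS_of_parallel_q M heI he' hne hpar (ih _ (hdel e he) (M ＼ {e}) rfl (p' + 1) hp)
      (hprev (M ／ {e}) p' (by omega))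
  push Not at hP
  -- Case 3: simple
  have hs : ∀ e ∈ M.E, ∀ f ∈ M.E, e ≠ f → M.eRk {e, f} = 2 :=
    fun e he f hf hef => eRk_pair_eq_two_of_simple M hL (fun e he e' he' hne => hP e he e' he' hne) he hf hef
  rcases lt_trichotomy M.eRank (p : ℕ∞) with hlt | heq | hgt
  · exact RLS_of_eRank_lt M hlt
  · -- `r(E) = p`
    by_cases hC : ∃ e, M.IsColoop e
    · obtain ⟨e, hcol⟩ := hC
      obtain ⟨p', rfl⟩ : ∃ p', p = p' + 1 := ⟨p - 1, by omega⟩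
      refine RLS_of_coloop_q M (by omega) hcol heq ?_
      rcases Nat.lt_or_ge (q + 2) p' with h | h
      · exact ih _ (hdel e hcol.mem_ground) (M ＼ {e}) rfl p' (by omega)
      · exact RLS_of_le (M ＼ {e}) (by omega)
    · push Not at hC
      -- an element without an `e`-free partition closes the step
      by_cases hU : ∃ e ∈ M.E, ∀ A ⊆ M.E \ {e}, e ∈ M.closure A ∨ e ∈ M.closure ((M.E \ {e}) \ A)
      · obtain ⟨e, he, hunsp⟩ := hU
        have heI : M.Indep {e} := _root_.Matroid.indep_singleton.2 ((_root_.Matroid.not_isLoop_iff he).1 (hL e he))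
        obtain ⟨p', rfl⟩ : ∃ p', p = p' + 1 := ⟨p - 1, by omega⟩
        exact RLS_of_unspanned_q M heI hunsp (ih _ (hdel e he) (M ＼ {e}) rfl (p' + 1) hp)
          (hprev (M ／ {e}) p' (by omega))
      · push Not at hU
        -- an element with a non-positive cross term closes the step
        by_cases hZ : ∃ e ∈ M.E, Matroid.freeCount M e (p - 1) (q + 1) ≤ Matroid.freeCount M e (p - 1) q
        · obtain ⟨e, he, h0⟩ := hZ
          have heI : M.Indep {e} :=
            _root_.Matroid.indep_singleton.2 ((_root_.Matroid.not_isLoop_iff he).1 (hL e he))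
          obtain ⟨p', rfl⟩ : ∃ p', p = p' + 1 := ⟨p - 1, by omega⟩
          rw [Nat.add_sub_cancel] at h0
          exact RLS_of_freeCount_le M heI heq h0 (ih _ (hdel e he) (M ＼ {e}) rfl (p' + 1) hp)
            (hprev (M ／ {e}) p' (by omega))
        · push Not at hZ
          exact hcore M p hp hs heq hC (fun e he => by
            obtain ⟨A, hA, h⟩ := hU e he
            exact ⟨A, hA, h.1, h.2⟩) (fun e he => hZ e he)
  · -- `r(E) > p`: truncate, then the same dichotomy on the truncation (same ground set, so the same size)
    have hp2 : 2 ≤ p := by omega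
    set T := Matroid.truncate M p with hTdef
    have hTs := truncate_pair_eRk M hp2 hs
    have hTR := truncate_eRank_eq M hgt
    have hTc := truncate_no_coloop M hgt
    have hTE : T.E = M.E := Matroid.truncate_ground M p
    have hT : RLS T p (q + 1) := by
      by_cases hU : ∃ e ∈ T.E, ∀ A ⊆ T.E \ {e}, e ∈ T.closure A ∨ e ∈ T.closure ((T.E \ {e}) \ A)
      · obtain ⟨e, he, hunsp⟩ := hU
        have heT : T.Indep {e} := by
          rw [Matroid.truncate_indep_iff]
          refine ⟨_root_.Matroid.indep_singleton.2 ((_root_.Matroid.not_isLoop_iff (hTE ▸ he)).1 (hL e (hTE ▸ he))), ?_⟩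
          rw [Set.ncard_singleton]; omega
        have hdelT : (T ＼ {e}).E.ncard < n := by
          rw [_root_.Matroid.delete_ground, hTE, ← hn, ← Set.ncard_sdiff_singleton_add_one (hTE ▸ he) M.ground_finite]
          omega
        obtain ⟨p', rfl⟩ : ∃ p', p = p' + 1 := ⟨p - 1, by omega⟩
        exact RLS_of_unspanned_q T heT hunsp (ih _ hdelT (T ＼ {e}) rfl (p' + 1) hp)
          (hprev (T ／ {e}) p' (by omega))
      · push Not at hU
        by_cases hZ : ∃ e ∈ T.E, Matroid.freeCount T e (p - 1) (q + 1) ≤ Matroid.freeCount T e (p - 1) q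
        · obtain ⟨e, he, h0⟩ := hZ
          have heT : T.Indep {e} := by
            rw [Matroid.truncate_indep_iff]
            refine ⟨_root_.Matroid.indep_singleton.2 ((_root_.Matroid.not_isLoop_iff (hTE ▸ he)).1 (hL e (hTE ▸ he))), ?_⟩
            rw [Set.ncard_singleton]; omega
          have hdelT : (T ＼ {e}).E.ncard < n := by
            rw [_root_.Matroid.delete_ground, hTE, ← hn, ← Set.ncard_sdiff_singleton_add_one (hTE ▸ he) M.ground_finite]
            omega
          obtain ⟨p', rfl⟩ : ∃ p', p = p' + 1 := ⟨p - 1, by omega⟩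
          rw [Nat.add_sub_cancel] at h0
          exact RLS_of_freeCount_le T heT hTR h0 (ih _ hdelT (T ＼ {e}) rfl (p' + 1) hp)
            (hprev (T ／ {e}) p' (by omega))
        · push Not at hZ
          exact hcore T p hp hTs hTR hTc (fun e he => by
            obtain ⟨A, hA, h⟩ := hU e he
            exact ⟨A, hA, h.1, h.2⟩) (fun e he => hZ e he)
    unfold RLS at hT ⊢
    exact Matroid.rls_of_truncate M p (by omega) (phiK p (q + 1)) (by unfold phiK; positivity) hT


/-- **`C025` at `q = 3` from the positive-cross-term core**: the core may assume `n⁰⁰_{p−1,2}(e) < n⁰⁰_{p−1,3}(e)` for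
every element (`D_e > 0`). -/
theorem c025_three_of_core_cross
    (hcore : ∀ (M : Matroid α) [M.Finite] (p : ℕ), 5 ≤ p →
      (∀ e ∈ M.E, ∀ f ∈ M.E, e ≠ f → M.eRk {e, f} = 2) → M.eRank = (p : ℕ∞) →
      (∀ e, ¬ M.IsColoop e) →
      (∀ e ∈ M.E, ∃ A ⊆ M.E \ {e}, e ∉ M.closure A ∧ e ∉ M.closure ((M.E \ {e}) \ A)) →
      (∀ e ∈ M.E, Matroid.freeCount M e (p - 1) 2 < Matroid.freeCount M e (p - 1) 3) → RLS M p 3) :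
    ∀ (M : Matroid α) [M.Finite] (p : ℕ), 5 ≤ p → RLS M p 3 :=
  rls_succ_all_cross 2 (fun M _ p hp => c025_two_all M p hp) hcore

end ThmN

end PercRepro
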